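import Literature.AlgebraicGeometry.Morphisms.FlatProjectiveFamilyHilbertPolynomialLocallyConstant
import Literature.AlgebraicGeometry.Motives.FlatFamilyHilbertPolynomialGrassmannianPoint
import HarnessLib

/-!
# The Hilbert polynomial of a flat family `Z ⊆ 𝐏(ι; T)` is a LOCALLY CONSTANT function on ANY locally Noetherian base `T`

Layer `Literature/AlgebraicGeometry/Morphisms`, namespace `Literature.AlgebraicGeometry.Morphisms`.  Theorems only: no definition, no
named fact, no instance, no notation, no `sorry`.  Universe `0`.

This is the scheme-level form of ★ `Morphisms/FlatProjectiveFamilyHilbertPolynomialLocallyConstant` (Hartshorne III Thm. 9.9 and the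
remark after it; EGA III 7.9.11; Hartshorne, *Connectedness of the Hilbert scheme*, Thm. 1.2: «`f : X → Y` projective, `Y` locally
noetherian, `F` flat over `Y` ⇒ `y ↦ P_y` is locally constant on `Y`»), in the model of record of the cell: `i : Z ⟶ 𝐏(ι; T)` a closed
immersion with `p_Z = i ≫ projectiveSpaceFst ι T` FLAT, `𝒪_Z(e) = SerreTwist.twistMod (i ≫ pr₂) (unitModule Z) e`
(`pr₂ : 𝐏(ι; T) → 𝐏ⁿ_ℤ`), field points `(k, f₀, x)` with `IsPullback k f₀ p_Z x`, and the two LETTERS of cohomology-and-base-change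
`Ext¹(𝒪_{X₀}, k^*𝒪_Z(e)) = 0`, `dim_K Γ(X₀, k^*𝒪_Z(e)) = P(e)`.

* §1 **`exists_affineChart_hilbertPolynomial`** — on an affine open `U = Spec R ⊆ T` (`R = Γ(T, U)` Noetherian): a locally constant
  `P_U : Spec R → ℚ[X]` such that for every field point `x` of `T` through `U` — i.e. `x` hits `fromSpec s` for some `s : Spec R` — and
  every cartesian square over `x`, both letters hold with `P_U s` from Mumford's threshold `B(P_U s) − 1` on (the `R`-model
  `ι_U : Z_U ⟶ 𝐏ʳ_R` of ★ `Motives.exists_closedImmersion_fibre`, ★ `SerreTwist.exists_pullback_twistMod_iso_of_sq`, and the affine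
  theorem ★ `exists_isLocallyConstant_hilbertPolynomial_fieldPoint`).
* §2 **`exists_isLocallyConstant_hilbertPolynomial_scheme`** — a LOCALLY CONSTANT `P : T → ℚ[X]` such that for every field point `x`
  of `T`, every cartesian square over it, the point `t` hit by `x` and every `e ≥ B(P t) − 1`: `Ext¹(𝒪_{X₀}, k^*𝒪_Z(e)) = 0` and
  `dim_K Γ(X₀, k^*𝒪_Z(e)) = (P t)(e)`.  Chart independence: two charts through `t` both read the ranks at the `κ(t)`-fibre.
  Consequently the level sets `{t | P t = Q}` are clopen (Mathlib `IsLocallyConstant.isClopen_fiber`), and on each of them ★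
  `Modules.hasRank_pushforward_twistMod_of_forall_fieldPoint` ∕ ★ `Motives.exists_universal_flat_family` apply with ONE polynomial.

Cell hodgecm-mathlib, F-4 (II-b) Hom-scheme assembly (b4) (B-p20 (g14) census v2 §2 (b4): the clopen decomposition `T = ⨆_Q T_Q` of
the test scheme of a flat graph), B-p14 (g20).  Count-neutral capital: HC_CM is proved only modulo the 7 printed citations until rung 0
closes; nothing here bears on it.

## References

* R. Hartshorne, *Algebraic Geometry*, GTM 52 (1977), III Thm. 9.9 (p. 261). [Hartshorne1977]
* A. Grothendieck, *EGA III₂* (Publ. Math. IHÉS 17, 1963), 7.9.11. [EGAIII2]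
* D. Mumford, *Lectures on Curves on an Algebraic Surface* (1966), Lecture 8, 3° (ii). [Mumford1966CurvesSurface]
* U. Görtz, T. Wedhorn, *Algebraic Geometry I* (2nd ed., 2020), Section (4.12) (p. 113) (`𝐏(ι; T)` and its base change). [GortzWedhorn2020]
-/

noncomputable section

set_option backward.isDefEq.respectTransparency false

open CategoryTheory CategoryTheory.Limits CategoryTheory.Abelian AlgebraicGeometry TopologicalSpace Opposite Polynomial
open Literature.Algebra.Homology Literature.Algebra.Homology.LaurentCech Literature.Algebra.Homology.OrderedCech
open Literature.AlgebraicGeometry.Morphisms.ProjCech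
open Literature.AlgebraicGeometry.Modules Literature.AlgebraicGeometry.Modules.SerreTwist Literature.AlgebraicGeometry.Motives

namespace Literature.AlgebraicGeometry.Morphisms

/-- Two rational polynomials agreeing at every natural number beyond a threshold are equal. [folklore] -/
private theorem eq_of_forall_le_eval_eq' (P Q : ℚ[X]) (n : ℕ) (h : ∀ e : ℕ, n ≤ e → P.eval (e : ℚ) = Q.eval (e : ℚ)) : P = Q := by
  apply Polynomial.eq_of_infinite_eval_eq P Q
  refine Set.Infinite.mono (s := (fun e : ℕ => (e : ℚ)) '' {e : ℕ | n ≤ e}) ?_ ?_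
  · rintro _ ⟨e, he, rfl⟩
    exact h e he
  · refine Set.Infinite.image (fun a _ b _ hab => by exact_mod_cast hab) ?_
    exact Set.infinite_of_forall_exists_gt fun m => ⟨max m n + 1, by change n ≤ max m n + 1; omega, by omega⟩

/-- `Ext`-vanishing transports along an isomorphism of the second argument. [folklore] -/
private theorem subsingleton_ext_of_iso₃ {C : Type*} [Category C] [Abelian C] [HasExt.{1} C] (P : C) {Y Y' : C}
    (e : Y ≅ Y') (i : ℕ) (h : Subsingleton (Ext.{1} P Y' i)) : Subsingleton (Ext.{1} P Y i) := by
  refine subsingleton_of_forall_eq 0 fun x => ?_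
  have hx : x = (x.comp (Ext.mk₀ e.hom) (add_zero i)).comp (Ext.mk₀ e.inv) (add_zero i) := by
    rw [Ext.comp_assoc_of_second_deg_zero, Ext.mk₀_comp_mk₀, e.hom_inv_id, Ext.comp_mk₀_id]
  rw [hx, Subsingleton.elim (x.comp (Ext.mk₀ e.hom) (add_zero i)) 0, Ext.zero_comp]

variable {ι : Type} {T Z : Scheme.{0}} [IsLocallyNoetherian T] (i : Z ⟶ Morphisms.projectiveSpace ι T)
  [IsClosedImmersion i] [Flat (i ≫ Morphisms.projectiveSpaceFst ι T)]

/-! ## §1 An affine chart of the base: one locally constant polynomial serving every field point through it -/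

include i in
/-- **The Hilbert polynomial on an affine chart of the base.**  For `U ⊆ T` affine open (`R = Γ(T, U)`, Noetherian) there is a
locally constant `P_U : Spec R → ℚ[X]` such that for every field point `x : Spec K → T` hitting `fromSpec s` (`s : Spec R`), every
cartesian square `X₀ = Z ×_T Spec K` and every `e ≥ B(P_U s) − 1`: `Ext¹(𝒪_{X₀}, k^*𝒪_Z(e)) = 0` and `dim_K Γ(X₀, k^*𝒪_Z(e)) = (P_U s)(e)`
— the `R`-model `Z_U ⊆ 𝐏ʳ_R` of `Z ×_T U` (★ `Motives.exists_closedImmersion_fibre`) is a flat embedded family over the Noetherian ring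
`R`, ★ `exists_isLocallyConstant_hilbertPolynomial_fieldPoint` serves its field points, and `x` factors through `U`.
[cite: Hartshorne1977, III Thm. 9.9 (p. 261)] [cite: EGAIII2, 7.9.11] [cite: GortzWedhorn2020, Section (4.12) (p. 113)] -/
theorem exists_affineChart_hilbertPolynomial (hr : 1 ≤ Nat.card ι) (U : T.affineOpens) :
    ∃ PU : PrimeSpectrum Γ(T, U) → ℚ[X], IsLocallyConstant PU ∧
      ∀ ⦃K : Type⦄ [Field K] ⦃X₀ : Scheme.{0}⦄ (k : X₀ ⟶ Z) (f₀ : X₀ ⟶ Spec (CommRingCat.of K))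
        (x : Spec (CommRingCat.of K) ⟶ T), IsPullback k f₀ (i ≫ Morphisms.projectiveSpaceFst ι T) x →
        ∀ s : PrimeSpectrum Γ(T, U), U.2.fromSpec.base s ∈ Set.range x.base →
        ∀ e : ℕ, regularityBound (preHilbertPoly ℚ (Nat.card ι) 0) 0 (preHilbertPoly ℚ (Nat.card ι) 0 - PU s) - 1 ≤ (e : ℤ) →
          Subsingleton (Ext.{1} (unitModule X₀) ((Scheme.Modules.pullback k).obj
            (twistMod (i ≫ pullback.snd (terminal.from T) (terminal.from (Morphisms.projectiveSpaceInt ι)))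
              (unitModule Z) e)) 1) ∧
          ((Module.finrank Γ(Spec (CommRingCat.of K), ⊤) (SecMod ((Scheme.Modules.pullback k).obj
            (twistMod (i ≫ pullback.snd (terminal.from T) (terminal.from (Morphisms.projectiveSpaceInt ι)))
              (unitModule Z) e)) f₀.appTop.hom ⊤) : ℕ) : ℚ) = (PU s).eval (e : ℚ) := by
  letI : Algebra intU.{0} Γ(T, U) := ULift.algebra' ℤ _
  haveI : IsNoetherianRing Γ(T, U) := IsLocallyNoetherian.component_noetherian U
  set p := i ≫ Morphisms.projectiveSpaceFst ι T with hp
  set ιZ := i ≫ pullback.snd (terminal.from T) (terminal.from (Morphisms.projectiveSpaceInt ι)) with hιZ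
  -- the square over the chart `j = fromSpec : Spec R → T` and the `R`-model of `Z_U`
  set j := U.2.fromSpec with hj
  have HU := IsPullback.of_hasPullback p j
  set pr := pullback.fst p j
  set pU := pullback.snd p j
  obtain ⟨ιU, hιU, h1, hsq⟩ := Motives.exists_closedImmersion_fibre i HU
  haveI := hιU
  have hpU : strZ ιU = pU := h1
  haveI : Flat (strZ ιU) := by rw [hpU]; exact MorphismProperty.of_isPullback HU inferInstance
  haveI : IsProper (strZ ιU) := by rw [hpU]; exact MorphismProperty.of_isPullback HU inferInstance
  have HU' : IsPullback pr (strZ ιU) p j := by rw [hpU]; exact HU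
  have φU : ∀ e : ℕ, Nonempty ((Scheme.Modules.pullback pr).obj (twistMod ιZ (unitModule Z) e) ≅
      twistMod ιU (unitModule _) e) := fun e => by
    obtain ⟨φ, -, -⟩ := exists_pullback_twistMod_iso_of_sq intU Γ(T, U) pr ιZ ιU hsq e
    exact ⟨φ⟩
  -- the affine theorem on the `R`-model
  obtain ⟨PU, hPU, hlet⟩ := exists_isLocallyConstant_hilbertPolynomial_fieldPoint hr ιU
  refine ⟨PU, hPU, fun K _ X₀ k f₀ x H s hs e he => ?_⟩
  -- `x` factors through the chart: `x = x' ≫ j`, `x' = Spec φ`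
  obtain ⟨q₀, hq₀⟩ := hs
  have hrange : Set.range x.base ⊆ Set.range j.base := by
    rintro _ ⟨q, rfl⟩
    rw [Subsingleton.elim q q₀, hq₀]
    exact ⟨s, rfl⟩
  let x' : Spec (CommRingCat.of K) ⟶ Spec Γ(T, U) := IsOpenImmersion.lift j x hrange
  have hx' : x' ≫ j = x := IsOpenImmersion.lift_fac j x hrange
  obtain ⟨φ, hφ⟩ : ∃ φ : Γ(T, U) →+* K, x' = Spec.map (CommRingCat.ofHom φ) :=
    ⟨(Spec.preimage x').hom, by rw [CommRingCat.ofHom_hom, Spec.map_preimage]⟩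
  -- the point `s` is `ker φ`
  have hs' : (⟨RingHom.ker φ, RingHom.ker_isPrime φ⟩ : PrimeSpectrum Γ(T, U)) = s := by
    have h1' : x'.base q₀ = s := by
      apply j.isOpenEmbedding.injective
      rw [← Scheme.Hom.comp_apply, hx', hq₀]
    rw [← h1', hφ]
    ext1
    change RingHom.ker φ = (PrimeSpectrum.comap φ q₀).asIdeal
    rw [PrimeSpectrum.comap_asIdeal, RingHom.ker_eq_comap_bot,
      (Ideal.eq_bot_or_top q₀.asIdeal).resolve_right q₀.isPrime.ne_top]
  -- lift the square to the `R`-model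
  let k' : X₀ ⟶ pullback p j := HU.lift k (f₀ ≫ x') (by rw [Category.assoc, hx']; exact H.w)
  have hk' : k' ≫ pr = k := HU.lift_fst _ _ _
  have hf' : k' ≫ pU = f₀ ≫ x' := HU.lift_snd _ _ _
  clear_value k'
  subst hk'
  have H' : IsPullback (k' ≫ pr) f₀ p (x' ≫ j) := by rw [hx']; exact H
  have Hk : IsPullback k' f₀ (strZ ιU) (Spec.map (CommRingCat.ofHom φ)) := by
    rw [hpU, ← hφ]; exact IsPullback.of_right H' hf' HU
  obtain ⟨hvan, hrk⟩ := hlet k' f₀ φ Hk e (by rw [hs']; exact he)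
  -- transport the module: `(k' ≫ pr)^*𝒪_Z(e) ≅ k'^*𝒪_{Z_U}(e)`
  let Ψ : (Scheme.Modules.pullback (k' ≫ pr)).obj (twistMod ιZ (unitModule Z) e) ≅
      (Scheme.Modules.pullback k').obj (twistMod ιU (unitModule _) e) :=
    ((Scheme.Modules.pullbackComp k' pr).app (twistMod ιZ (unitModule Z) e)).symm ≪≫
      (Scheme.Modules.pullback k').mapIso (φU e).some
  refine ⟨subsingleton_ext_of_iso₃ (unitModule X₀) Ψ 1 hvan, ?_⟩
  obtain ⟨L, -⟩ := exists_secMod_linearEquiv_of_iso f₀.appTop.hom Ψ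
  rw [L.finrank_eq, ← hs']
  exact hrk

/-! ## §2 The locally constant Hilbert polynomial on the base -/

include i in
/-- **The Hilbert polynomial of a FLAT family `Z ⊆ 𝐏(ι; T)` is a LOCALLY CONSTANT function on the locally Noetherian base `T`**
(Hartshorne III Thm. 9.9 and the remark after it; EGA III 7.9.11): there is `P : T → ℚ[X]`, locally constant, such that for every field
point `x : Spec K → T`, every cartesian square `X₀ = Z ×_T Spec K`, the point `t` hit by `x` and every `e ≥ B(P t) − 1`:
`Ext¹(𝒪_{X₀}, k^*𝒪_Z(e)) = 0` and `dim_K Γ(X₀, k^*𝒪_Z(e)) = (P t)(e)`.  `P t` is read on an affine chart through `t` (§1); two charts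
agree at `t` because both read the ranks at the `κ(t)`-fibre for `e ≫ 0`; local constancy is that of the chart polynomial.
[cite: Hartshorne1977, III Thm. 9.9 (p. 261)] [cite: EGAIII2, 7.9.11] [cite: Mumford1966CurvesSurface, Lecture 8, 3° (ii)] -/
theorem exists_isLocallyConstant_hilbertPolynomial_scheme (hr : 1 ≤ Nat.card ι) :
    ∃ P : T → ℚ[X], IsLocallyConstant P ∧
      ∀ ⦃K : Type⦄ [Field K] ⦃X₀ : Scheme.{0}⦄ (k : X₀ ⟶ Z) (f₀ : X₀ ⟶ Spec (CommRingCat.of K))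
        (x : Spec (CommRingCat.of K) ⟶ T), IsPullback k f₀ (i ≫ Morphisms.projectiveSpaceFst ι T) x →
        ∀ t : T, t ∈ Set.range x.base →
        ∀ e : ℕ, regularityBound (preHilbertPoly ℚ (Nat.card ι) 0) 0 (preHilbertPoly ℚ (Nat.card ι) 0 - P t) - 1 ≤ (e : ℤ) →
          Subsingleton (Ext.{1} (unitModule X₀) ((Scheme.Modules.pullback k).obj
            (twistMod (i ≫ pullback.snd (terminal.from T) (terminal.from (Morphisms.projectiveSpaceInt ι)))
              (unitModule Z) e)) 1) ∧
          ((Module.finrank Γ(Spec (CommRingCat.of K), ⊤) (SecMod ((Scheme.Modules.pullback k).obj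
            (twistMod (i ≫ pullback.snd (terminal.from T) (terminal.from (Morphisms.projectiveSpaceInt ι)))
              (unitModule Z) e)) f₀.appTop.hom ⊤) : ℕ) : ℚ) = (P t).eval (e : ℚ) := by
  classical
  -- an affine chart through every point, and the chart polynomials
  have hchart : ∀ t : T, ∃ U : T.affineOpens, t ∈ (U : T.Opens) := fun t => by
    obtain ⟨_, ⟨U, hU, rfl⟩, htU, -⟩ := T.isBasis_affineOpens.exists_subset_of_mem_open (Set.mem_univ t) isOpen_univ
    exact ⟨⟨U, hU⟩, htU⟩
  choose U hU using hchart
  have hPU := fun V : T.affineOpens => exists_affineChart_hilbertPolynomial i hr V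
  choose PU hPUlc hPUlet using hPU
  -- the polynomial at `t`, read on the chart `U t` at the point `s t` over `t`
  let s : ∀ t : T, PrimeSpectrum Γ(T, U t) := fun t => (U t).2.primeIdealOf ⟨t, hU t⟩
  have hs : ∀ t : T, (U t).2.fromSpec.base (s t) = t := fun t => (U t).2.fromSpec_primeIdealOf ⟨t, hU t⟩
  refine ⟨fun t => PU (U t) (s t), ?_, fun K _ X₀ k f₀ x H t ht e he => hPUlet (U t) k f₀ x H (s t) (by rw [hs]; exact ht) e he⟩
  -- local constancy: compare two charts at a point through the `κ(t')`-fibre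
  rw [IsLocallyConstant.iff_exists_open]
  intro t
  obtain ⟨V', hV'open, hsV', hV'⟩ := (IsLocallyConstant.iff_exists_open _).mp (hPUlc (U t)) (s t)
  refine ⟨(U t).2.fromSpec.base '' V', (U t).2.fromSpec.isOpenEmbedding.isOpenMap _ hV'open,
    ⟨s t, hsV', hs t⟩, ?_⟩
  rintro t' ⟨s', hs'V, rfl⟩
  rw [← hV' s' hs'V]
  -- both polynomials read the ranks at the residue-field point of `t' = fromSpec s'`
  set t' := (U t).2.fromSpec.base s' with ht'
  let K : Type := IsLocalRing.ResidueField (T.presheaf.stalk t')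
  let x : Spec (CommRingCat.of K) ⟶ T := T.fromSpecResidueField t'
  have hx : t' ∈ Set.range x.base := by
    rw [show Set.range x.base = {t'} from T.range_fromSpecResidueField t']
    exact Set.mem_singleton t'
  have H := IsPullback.of_hasPullback (i ≫ Morphisms.projectiveSpaceFst ι T) x
  set B₁ := (regularityBound (preHilbertPoly ℚ (Nat.card ι) 0) 0 (preHilbertPoly ℚ (Nat.card ι) 0 - PU (U t') (s t')) - 1).toNat
  set B₂ := (regularityBound (preHilbertPoly ℚ (Nat.card ι) 0) 0 (preHilbertPoly ℚ (Nat.card ι) 0 - PU (U t) s') - 1).toNat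
  refine eq_of_forall_le_eval_eq' _ _ (max B₁ B₂) fun e he => ?_
  have he₁ : regularityBound (preHilbertPoly ℚ (Nat.card ι) 0) 0 (preHilbertPoly ℚ (Nat.card ι) 0 - PU (U t') (s t')) - 1 ≤
      (e : ℤ) := by
    have := Int.self_le_toNat
      (regularityBound (preHilbertPoly ℚ (Nat.card ι) 0) 0 (preHilbertPoly ℚ (Nat.card ι) 0 - PU (U t') (s t')) - 1)
    have h2 : B₁ ≤ e := (le_max_left _ _).trans he
    omega
  have he₂ : regularityBound (preHilbertPoly ℚ (Nat.card ι) 0) 0 (preHilbertPoly ℚ (Nat.card ι) 0 - PU (U t) s') - 1 ≤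
      (e : ℤ) := by
    have := Int.self_le_toNat
      (regularityBound (preHilbertPoly ℚ (Nat.card ι) 0) 0 (preHilbertPoly ℚ (Nat.card ι) 0 - PU (U t) s') - 1)
    have h2 : B₂ ≤ e := (le_max_right _ _).trans he
    omega
  obtain ⟨-, h₁⟩ := hPUlet (U t') (pullback.fst _ _) (pullback.snd _ _) x H (s t') (by rw [hs]; exact hx) e he₁
  obtain ⟨-, h₂⟩ := hPUlet (U t) (pullback.fst _ _) (pullback.snd _ _) x H s' hx e he₂
  exact h₁.symm.trans h₂

end Literature.AlgebraicGeometry.Morphisms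

end
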